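import Summits.RiemannHypothesis.RiemannHypothesis.Theorems.WeilTwoPrimeDeflC83XBase
import Literature.NumberTheory.LFunctions.WeilBlockRowsFast
import HarnessLib

/-!
# Deflated two-prime certificate (weilCertDeflC83X): the Bessel block claim `Hp = C H Cᵀ` (parity 0), rows 10–14, fast check

`WeilCert.checkHpRowT` (linear traversals) instead of the indexed `checkHpRow` decide.  Pure proof file.
-/

set_option linter.dupNamespace false

noncomputable section

namespace Summit.RiemannHypothesis.RiemannHypothesis.Theorems.EvenWinsBeyondArch

open Literature.NumberTheory.LFunctions

set_option maxHeartbeats 0 in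
/-- Fast kernel check of claim row 10 of `Hp = C H Cᵀ` (parity 0; linear traversals, triangular `C`). [folklore] -/
theorem checkHpRowT0_10_weilCertDeflC83X : weilCertDeflC83XBase.checkHpRowT weilCertDeflC83XHpE 0 10 = true := by
  decide +kernel

/-- Claim row 10 of `Hp = C H Cᵀ` (parity 0), from the fast check. [folklore] -/
theorem checkHpRow0_10_weilCertDeflC83X : weilCertDeflC83XBase.checkHpRow weilCertDeflC83XHpE 0 10 = true :=
  WeilCert.checkHpRow_of_T checkHpRowT0_10_weilCertDeflC83X

set_option maxHeartbeats 0 in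
/-- Fast kernel check of claim row 11 of `Hp = C H Cᵀ` (parity 0; linear traversals, triangular `C`). [folklore] -/
theorem checkHpRowT0_11_weilCertDeflC83X : weilCertDeflC83XBase.checkHpRowT weilCertDeflC83XHpE 0 11 = true := by
  decide +kernel

/-- Claim row 11 of `Hp = C H Cᵀ` (parity 0), from the fast check. [folklore] -/
theorem checkHpRow0_11_weilCertDeflC83X : weilCertDeflC83XBase.checkHpRow weilCertDeflC83XHpE 0 11 = true :=
  WeilCert.checkHpRow_of_T checkHpRowT0_11_weilCertDeflC83X

set_option maxHeartbeats 0 in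
/-- Fast kernel check of claim row 12 of `Hp = C H Cᵀ` (parity 0; linear traversals, triangular `C`). [folklore] -/
theorem checkHpRowT0_12_weilCertDeflC83X : weilCertDeflC83XBase.checkHpRowT weilCertDeflC83XHpE 0 12 = true := by
  decide +kernel

/-- Claim row 12 of `Hp = C H Cᵀ` (parity 0), from the fast check. [folklore] -/
theorem checkHpRow0_12_weilCertDeflC83X : weilCertDeflC83XBase.checkHpRow weilCertDeflC83XHpE 0 12 = true :=
  WeilCert.checkHpRow_of_T checkHpRowT0_12_weilCertDeflC83X

set_option maxHeartbeats 0 in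
/-- Fast kernel check of claim row 13 of `Hp = C H Cᵀ` (parity 0; linear traversals, triangular `C`). [folklore] -/
theorem checkHpRowT0_13_weilCertDeflC83X : weilCertDeflC83XBase.checkHpRowT weilCertDeflC83XHpE 0 13 = true := by
  decide +kernel

/-- Claim row 13 of `Hp = C H Cᵀ` (parity 0), from the fast check. [folklore] -/
theorem checkHpRow0_13_weilCertDeflC83X : weilCertDeflC83XBase.checkHpRow weilCertDeflC83XHpE 0 13 = true :=
  WeilCert.checkHpRow_of_T checkHpRowT0_13_weilCertDeflC83X

set_option maxHeartbeats 0 in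
/-- Fast kernel check of claim row 14 of `Hp = C H Cᵀ` (parity 0; linear traversals, triangular `C`). [folklore] -/
theorem checkHpRowT0_14_weilCertDeflC83X : weilCertDeflC83XBase.checkHpRowT weilCertDeflC83XHpE 0 14 = true := by
  decide +kernel

/-- Claim row 14 of `Hp = C H Cᵀ` (parity 0), from the fast check. [folklore] -/
theorem checkHpRow0_14_weilCertDeflC83X : weilCertDeflC83XBase.checkHpRow weilCertDeflC83XHpE 0 14 = true :=
  WeilCert.checkHpRow_of_T checkHpRowT0_14_weilCertDeflC83X

end Summit.RiemannHypothesis.RiemannHypothesis.Theorems.EvenWinsBeyondArch
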